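import Summits.ValiantsHypothesis.ValiantsHypothesis.Theorems.BinomialCandidate.Negative.IntegralDeepSmallLevels

/-!
# `stub_polarDeep` (crux `BinomialCandidate`, stmt-ValiantsHypothesis-7392) fails at level `7`

Negative-lane certificate (refuter crux-attack (a), 2026-08-17) for the deciding crux's second open stub DEEP-POLAR
(`Cruxes/BinomialCandidate/Lines/registered.lean` v7, `Stmt.stub_polarDeep`: a Laurent solution with a genuine pole at the
place over `x = 0`, general exponents `a b : Fin m → ℕ`, conclusion = a nonzero relation of `ℓ¹`-length `≤ ⌊log₂ m⌋²`).

THE POLAR SWALLOWER (a second `k = 4` "piece design" of the seat's enumeration Exp. E — pieces of weights `1, 2, 6` with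
different centres and the monomial `x`, at the point `n₀ = 8/21`, `n₂ = 33/14`, `n₁ = 2n₂ - 5 = -2/7 < 0`, `x = t⁴²`):
hidden series `u₀ = t¹⁶ + t²⁶`, `u₁ = t⁻¹² + t⁹⁶` (THE POLE), `u₂ = t⁹⁹ + t¹⁵³`, `m = t⁴²` and two linear paddings; the
quadratic map `Γ = (y₀² - 2y₃, y₃y₀, y₃y₁, y₂, y₁y₂ - y₃y₂, y₄, y₅) : ℂ⁶ → ℂ⁷` sends them to SEVEN unit binomials
`tᵃⁱ + tᵇⁱ`, `a = (32, 58, 30, 99, 87, 314, 391)`, `b = (52, 68, 138, 153, 249, 377, 480)` (Chebyshev `u₀² - 2m`, the shifts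
`m u₀`, `m u₁` — the pole is swallowed by the shift — the bare piece `u₂`, and the cyclotomic coupling `(u₁ - m) u₂ = t⁸⁷ + t²⁴⁹`),
whose fourteen exponents admit NO nonzero integer relation of `ℓ¹`-length `≤ 4 = ⌊log₂ 7⌋²` (kernel-checked certificate `noRel`
of the companion file).  Local type: least order `μ = -12`, `p_μ = e₁`; `B_i(e₁) = 0` for all `i`; the step-2 dichotomy holds
through its first branch with the isotropic second direction `z' = e₀` (`B_i(e₁, e₀) = 0` for ALL `i`); the structure at
infinity holds with `z = e₁`, `z' = e₀`.  Hence: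

* `polarDeepV7_level_seven_false` — the level-`7` body of `Stmt.stub_polarDeep` (v7 text) is false;
* `eight_le_of_polarDeepV7_witness` — every witness `m₀` of `Stmt.stub_polarDeep` has `8 ≤ m₀`.

Together with `IntegralDeepSmallLevels(V7)`: BOTH open stubs of the registered line are false at levels `5, 6, 7` for general
data; neither finite-level kill refutes the `∃ m₀` statements (the designs have relation length exactly `5 < 9`).
No conclusion below asserts a Theses declaration positively.
-/

namespace Summit.ValiantsHypothesis.ValiantsHypothesis.Theorems.BinomialCandidate.Negative

-- summit = sub-problem name (single-conjunct summit, D-0017 layout), so the namespace repeats it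
set_option linter.dupNamespace false

open MvPolynomial

/-! ## Arithmetic: no short relation among the fourteen exponents -/

/-- Kernel evaluation of `noRel` on `(a₀, b₀, …, a₆, b₆)` of the polar swallower. [folklore] -/
theorem polar7_cert :
    noRel [32, 52, 58, 68, 30, 138, 99, 153, 87, 249, 314, 377, 391, 480] 4 0 false = true := by
  decide +kernel

/-- First exponents of the polar swallower. [folklore] -/
def polar7a : Fin 7 → ℕ := ![32, 58, 30, 99, 87, 314, 391]

/-- Second exponents of the polar swallower. [folklore] -/
def polar7b : Fin 7 → ℕ := ![52, 68, 138, 153, 249, 377, 480]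

/-- No short relation: the stub's conclusion fails for the polar swallower's exponents. [folklore] -/
theorem polar7_noShortRelation : ¬ ∃ u v : Fin 7 → ℤ, (u, v) ≠ 0 ∧
    ∑ i, (|u i| + |v i|) ≤ ((Nat.log 2 7 ^ 2 : ℕ) : ℤ) ∧ ∑ i, (u i * (polar7a i : ℤ) + v i * (polar7b i : ℤ)) = 0 := by
  rintro ⟨u, v, hne, hlen, hrel⟩
  apply hne
  have hlog : Nat.log 2 7 = 2 :=
    (Nat.log_eq_iff (b := 2) (m := 2) (n := 7) (Or.inl two_ne_zero)).mpr ⟨by norm_num, by norm_num⟩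
  rw [hlog] at hlen
  simp only [polar7a, polar7b, Fin.sum_univ_seven, Matrix.cons_val_zero, Matrix.cons_val_one,
    Matrix.cons_val] at hlen hrel
  have key := noRel_spec _ 4 0 false polar7_cert
    [u 0, v 0, u 1, v 1, u 2, v 2, u 3, v 3, u 4, v 4, u 5, v 5, u 6, v 6] rfl
    (by simp only [List.map_cons, List.map_nil, List.sum_cons, List.sum_nil]; push_cast at hlen ⊢; linarith)
    (by simp only [List.zipWith_cons_cons, List.zipWith_nil_right, List.sum_cons, List.sum_nil]
        push_cast at hrel ⊢; linarith)
  obtain ⟨-, hz⟩ := key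
  simp only [List.mem_cons, List.not_mem_nil, or_false, forall_eq_or_imp, forall_eq] at hz
  obtain ⟨h0, h1, h2, h3, h4, h5, h6, h7, h8, h9, h10, h11, h12, h13⟩ := hz
  refine Prod.ext (funext fun i => ?_) (funext fun i => ?_) <;> fin_cases i <;> assumption

/-! ## The polar swallower -/

/-- The quadratic map `ℂ⁶ → ℂ⁷` (without scalars: `2y₃ = y₃ + y₃`). [folklore] -/
noncomputable def polar7Γ : Fin 7 → MvPolynomial (Fin 6) ℂ :=
  ![X 0 ^ 2 - X 3 - X 3, X 3 * X 0, X 3 * X 1, X 2, X 1 * X 2 - X 3 * X 2, X 4, X 5]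

/-- The six hidden Laurent series; `u₁ = t⁻¹² + t⁹⁶` carries the pole. [folklore] -/
noncomputable def polar7p : Fin 6 → LaurentSeries ℂ :=
  ![level7s 16 + level7s 26, HahnSeries.single (-12 : ℤ) (1 : ℂ) + level7s 96, level7s 99 + level7s 153, level7s 42,
    level7s 314 + level7s 377, level7s 391 + level7s 480]

/-- All coordinates are quadratic. [folklore] -/
theorem polar7_deg : ∀ i, (polar7Γ i).totalDegree ≤ 2 := by
  have hX : ∀ j : Fin 6, (X j : MvPolynomial (Fin 6) ℂ).totalDegree ≤ 2 := fun j => by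
    simp [totalDegree_X]
  have hXX : ∀ j k : Fin 6, (X j * X k : MvPolynomial (Fin 6) ℂ).totalDegree ≤ 2 := fun j k =>
    (totalDegree_mul _ _).trans (by simp [totalDegree_X])
  have hX2 : ∀ j : Fin 6, (X j ^ 2 : MvPolynomial (Fin 6) ℂ).totalDegree ≤ 2 := fun j => by
    simp [totalDegree_X_pow]
  have hsub : ∀ f g : MvPolynomial (Fin 6) ℂ, f.totalDegree ≤ 2 → g.totalDegree ≤ 2 →
      (f - g).totalDegree ≤ 2 := fun f g hf hg => (totalDegree_sub f g).trans (max_le hf hg)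
  intro i
  fin_cases i
  · exact hsub _ _ (hsub _ _ (hX2 0) (hX 3)) (hX 3)
  · exact hXX 3 0
  · exact hXX 3 1
  · exact hX 2
  · exact hsub _ _ (hXX 1 2) (hXX 3 2)
  · exact hX 4
  · exact hX 5

/-- The solution equations `Γ(p) = (tᵃⁱ + tᵇⁱ)ᵢ` (with `N = 1`); the pole of `u₁` is swallowed. [folklore] -/
theorem polar7_sol : ∀ i, MvPolynomial.aeval polar7p (polar7Γ i) =
    HahnSeries.single ((1 * polar7a i : ℕ) : ℤ) (1 : ℂ) + HahnSeries.single ((1 * polar7b i : ℕ) : ℤ) (1 : ℂ) := by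
  intro i
  fin_cases i <;>
    simp only [polar7Γ, polar7p, level7s, polar7a, polar7b, Fin.zero_eta, Fin.mk_one, Fin.reduceFinMk, Fin.isValue,
      Matrix.cons_val_zero, Matrix.cons_val_one, Matrix.cons_val, map_sub, map_mul, MvPolynomial.aeval_X, sq,
      add_mul, mul_add, HahnSeries.single_mul_single, mul_one, one_mul, Nat.cast_ofNat] <;> norm_num
  all_goals abel

/-- Nothing below order `-12`. [folklore] -/
theorem polar7_below : ∀ j, ∀ g < (-12 : ℤ), (polar7p j).coeff g = 0 := by
  intro j g hg
  fin_cases j <;> simp only [polar7p, level7s, Fin.zero_eta, Fin.mk_one, Fin.reduceFinMk, Fin.isValue,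
    Matrix.cons_val_zero, Matrix.cons_val_one, Matrix.cons_val, HahnSeries.coeff_add', Pi.add_apply,
    HahnSeries.coeff_single] <;> split_ifs <;> first | omega | simp

/-- The leading (order `-12`) coefficient vector is `e₁`. [folklore] -/
theorem polar7_lead : (fun j => (polar7p j).coeff (-12 : ℤ)) = (Pi.single 1 1 : Fin 6 → ℂ) := by
  funext j
  fin_cases j <;> simp [polar7p, level7s]

/-- The quadratic parts `B_i`. [folklore] -/
theorem polar7_B : ∀ i, MvPolynomial.homogeneousComponent 2 (polar7Γ i) =
    (![X 0 ^ 2, X 3 * X 0, X 3 * X 1, 0, X 1 * X 2 - X 3 * X 2, 0, 0] : Fin 7 → MvPolynomial (Fin 6) ℂ) i := by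
  have h1 : ∀ j : Fin 6, MvPolynomial.homogeneousComponent 2 (X j : MvPolynomial (Fin 6) ℂ) = 0 :=
    fun j => by rw [homogeneousComponent_of_mem (isHomogeneous_X ℂ j)]; simp
  have h2 : ∀ j : Fin 6, MvPolynomial.homogeneousComponent 2 (X j ^ 2 : MvPolynomial (Fin 6) ℂ) = X j ^ 2 :=
    fun j => by rw [homogeneousComponent_of_mem (isHomogeneous_X_pow j 2)]; rfl
  have h11 : ∀ j k : Fin 6,
      MvPolynomial.homogeneousComponent 2 (X j * X k : MvPolynomial (Fin 6) ℂ) = X j * X k :=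
    fun j k => by rw [homogeneousComponent_of_mem ((isHomogeneous_X ℂ j).mul (isHomogeneous_X ℂ k))]; rfl
  intro i
  fin_cases i <;> simp [polar7Γ, map_sub, h1, h2, h11]

/-- `B_i(e₁) = 0` for all `i` (`Γ` is improper through the pole direction). [folklore] -/
theorem polar7_Be1 : ∀ i, MvPolynomial.eval (Pi.single 1 1 : Fin 6 → ℂ)
    (MvPolynomial.homogeneousComponent 2 (polar7Γ i)) = 0 := by
  intro i; rw [polar7_B i]; fin_cases i <;> simp

/-- `B_i(e₁, e₀) = 0` for all `i`: `z' = e₀` is an isotropic second direction for every coordinate. [folklore] -/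
theorem polar7_dBe1e0 : ∀ i, ∑ j, (Pi.single 0 1 : Fin 6 → ℂ) j * MvPolynomial.eval (Pi.single 1 1 : Fin 6 → ℂ)
    (MvPolynomial.pderiv j (MvPolynomial.homogeneousComponent 2 (polar7Γ i))) = 0 := by
  intro i
  rw [Fintype.sum_eq_single (0 : Fin 6) (fun j hj => by simp [hj]), Pi.single_eq_same, one_mul, polar7_B i]
  fin_cases i <;> simp [pderiv_X, Derivation.leibniz, sq]

/-! ## The level-`7` body of `Stmt.stub_polarDeep` (v7) is false -/

/-- **Level `7` of `Stmt.stub_polarDeep` (skeleton v7 text) fails**: witness the polar swallower, `N = 1`, `μ = -12`,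
step-2 dichotomy via the isotropic direction `e₀`, structure at infinity via `z = e₁`, `z' = e₀`.  Body quoted verbatim
with `m := 7`, `Fin (7 - 1)` written `Fin 6` (definitionally equal). [folklore] -/
theorem polarDeepV7_level_seven_false : ¬ (∀ (a b : Fin 7 → ℕ) (Γ : Fin 7 → MvPolynomial (Fin 6) ℂ) (N : ℕ)
    (p : Fin 6 → LaurentSeries ℂ) (μ : ℤ), (∀ i, (Γ i).totalDegree ≤ 2) → 0 < N →
    μ < 0 → (∀ j, ∀ g < μ, (p j).coeff g = 0) → (fun j => (p j).coeff μ) ≠ 0 →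
    (∀ i, MvPolynomial.eval (fun j => (p j).coeff μ) (MvPolynomial.homogeneousComponent 2 (Γ i)) = 0) →
    ((∃ z' : Fin 6 → ℂ, (∀ c : ℂ, z' ≠ c • (fun j => (p j).coeff μ)) ∧ ∀ i,
        ∑ j, z' j * MvPolynomial.eval (fun l => (p l).coeff μ)
          (MvPolynomial.pderiv j (MvPolynomial.homogeneousComponent 2 (Γ i))) = 0) ∨
      ((∀ j k, ∀ g < 0, ((p k).coeff μ • p j - (p j).coeff μ • p k).coeff g = 0) ∧
        ∃ w : Fin 6 → ℂ,
          (∀ j k, ((p k).coeff μ • p j - (p j).coeff μ • p k).coeff 0 = (p k).coeff μ * w j - (p j).coeff μ * w k) ∧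
          ∀ i, ∑ j, (p j).coeff μ * MvPolynomial.eval w (MvPolynomial.pderiv j (Γ i)) = 0)) →
    (∃ z : Fin 6 → ℂ, z ≠ 0 ∧ ∃ z' : Fin 6 → ℂ, (∀ c : ℂ, z' ≠ c • z) ∧
      (((∀ i, MvPolynomial.eval z (MvPolynomial.homogeneousComponent 2 (Γ i)) = 0) ∧
        ∃ i₁ : Fin 7, ∀ i, i ≠ i₁ →
          ∑ j, z' j * MvPolynomial.eval z
            (MvPolynomial.pderiv j (MvPolynomial.homogeneousComponent 2 (Γ i))) = 0) ∨
      (∃ τ : Fin 7, (∀ i, i ≠ τ → MvPolynomial.eval z (MvPolynomial.homogeneousComponent 2 (Γ i)) = 0) ∧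
        ∃ i₁ : Fin 7, ∀ i, i ≠ τ → i ≠ i₁ →
          ∑ j, z' j * MvPolynomial.eval z
            (MvPolynomial.pderiv j (MvPolynomial.homogeneousComponent 2 (Γ i))) = 0))) →
    (∀ i, MvPolynomial.aeval p (Γ i) =
      HahnSeries.single ((N * a i : ℕ) : ℤ) (1 : ℂ) + HahnSeries.single ((N * b i : ℕ) : ℤ) (1 : ℂ)) →
    ∃ u v : Fin 7 → ℤ, (u, v) ≠ 0 ∧ ∑ i, (|u i| + |v i|) ≤ ((Nat.log 2 7 ^ 2 : ℕ) : ℤ) ∧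
      ∑ i, (u i * (a i : ℤ) + v i * (b i : ℤ)) = 0) := by
  intro h
  have hne : (fun j => (polar7p j).coeff (-12 : ℤ)) ≠ 0 := by
    rw [polar7_lead]; exact fun h0 => by simpa using congrFun h0 1
  have hB : ∀ i, MvPolynomial.eval (fun j => (polar7p j).coeff (-12 : ℤ))
      (MvPolynomial.homogeneousComponent 2 (polar7Γ i)) = 0 := by
    rw [polar7_lead]; exact polar7_Be1
  have hz' : ∀ c : ℂ, (Pi.single 0 1 : Fin 6 → ℂ) ≠ c • (fun j => (polar7p j).coeff (-12 : ℤ)) := by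
    rw [polar7_lead]; exact fun c hc => by simpa using congrFun hc 0
  have hiso : ∀ i, ∑ j, (Pi.single 0 1 : Fin 6 → ℂ) j * MvPolynomial.eval (fun l => (polar7p l).coeff (-12 : ℤ))
      (MvPolynomial.pderiv j (MvPolynomial.homogeneousComponent 2 (polar7Γ i))) = 0 := by
    rw [polar7_lead]; exact polar7_dBe1e0
  refine absurd (h polar7a polar7b polar7Γ 1 polar7p (-12) polar7_deg one_pos (by norm_num) polar7_below hne hB
    (Or.inl ⟨Pi.single 0 1, hz', hiso⟩)
    ⟨Pi.single 1 1, ?_, Pi.single 0 1, ?_, Or.inl ⟨polar7_Be1, 0, fun i _ => polar7_dBe1e0 i⟩⟩ polar7_sol) ?_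
  · exact fun h0 => by simpa using congrFun h0 1
  · exact fun c hc => by simpa using congrFun hc 0
  · exact polar7_noShortRelation

/-- Every witness `m₀` of `Stmt.stub_polarDeep` (v7 text of `Cruxes/BinomialCandidate/Lines/registered.lean`, body at level `m`
quoted verbatim) satisfies `8 ≤ m₀`. [folklore] -/
theorem eight_le_of_polarDeepV7_witness (m₀ : ℕ)
    (hm : ∀ m ≥ m₀, ∀ (a b : Fin m → ℕ) (Γ : Fin m → MvPolynomial (Fin (m - 1)) ℂ) (N : ℕ)
    (p : Fin (m - 1) → LaurentSeries ℂ) (μ : ℤ), (∀ i, (Γ i).totalDegree ≤ 2) → 0 < N →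
    μ < 0 → (∀ j, ∀ g < μ, (p j).coeff g = 0) → (fun j => (p j).coeff μ) ≠ 0 →
    (∀ i, MvPolynomial.eval (fun j => (p j).coeff μ) (MvPolynomial.homogeneousComponent 2 (Γ i)) = 0) →
    ((∃ z' : Fin (m - 1) → ℂ, (∀ c : ℂ, z' ≠ c • (fun j => (p j).coeff μ)) ∧ ∀ i,
        ∑ j, z' j * MvPolynomial.eval (fun l => (p l).coeff μ)
          (MvPolynomial.pderiv j (MvPolynomial.homogeneousComponent 2 (Γ i))) = 0) ∨
      ((∀ j k, ∀ g < 0, ((p k).coeff μ • p j - (p j).coeff μ • p k).coeff g = 0) ∧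
        ∃ w : Fin (m - 1) → ℂ,
          (∀ j k, ((p k).coeff μ • p j - (p j).coeff μ • p k).coeff 0 = (p k).coeff μ * w j - (p j).coeff μ * w k) ∧
          ∀ i, ∑ j, (p j).coeff μ * MvPolynomial.eval w (MvPolynomial.pderiv j (Γ i)) = 0)) →
    (∃ z : Fin (m - 1) → ℂ, z ≠ 0 ∧ ∃ z' : Fin (m - 1) → ℂ, (∀ c : ℂ, z' ≠ c • z) ∧
      (((∀ i, MvPolynomial.eval z (MvPolynomial.homogeneousComponent 2 (Γ i)) = 0) ∧
        ∃ i₁ : Fin m, ∀ i, i ≠ i₁ →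
          ∑ j, z' j * MvPolynomial.eval z
            (MvPolynomial.pderiv j (MvPolynomial.homogeneousComponent 2 (Γ i))) = 0) ∨
      (∃ τ : Fin m, (∀ i, i ≠ τ → MvPolynomial.eval z (MvPolynomial.homogeneousComponent 2 (Γ i)) = 0) ∧
        ∃ i₁ : Fin m, ∀ i, i ≠ τ → i ≠ i₁ →
          ∑ j, z' j * MvPolynomial.eval z
            (MvPolynomial.pderiv j (MvPolynomial.homogeneousComponent 2 (Γ i))) = 0))) →
    (∀ i, MvPolynomial.aeval p (Γ i) =
      HahnSeries.single ((N * a i : ℕ) : ℤ) (1 : ℂ) + HahnSeries.single ((N * b i : ℕ) : ℤ) (1 : ℂ)) →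
    ∃ u v : Fin m → ℤ, (u, v) ≠ 0 ∧ ∑ i, (|u i| + |v i|) ≤ ((Nat.log 2 m ^ 2 : ℕ) : ℤ) ∧
      ∑ i, (u i * (a i : ℤ) + v i * (b i : ℤ)) = 0) :
    8 ≤ m₀ := by
  by_contra hlt
  exact polarDeepV7_level_seven_false (hm 7 (by omega))

end Summit.ValiantsHypothesis.ValiantsHypothesis.Theorems.BinomialCandidate.Negative
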